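import Mathlib
import HarnessLib
import Literature.MathematicalPhysics.QuantumLattice.HubbardBondAlgebra
import Literature.MathematicalPhysics.QuantumLattice.HubbardGaugeBound
import Literature.Barriers.HubbardSuperconductivity.HohenbergMerminWagnerPairing
import Summits.HubbardSuperconductivity.HubbardSuperconductivity.Theorems.ThermalWedgeTwSeededEnsembleEquivalenceRSourcedCut

/-!
# Route `ThermalWedge`, crux `TwSeededEnsembleEquivalenceR` (stmt-HubbardSuperconductivity-15581):
# pair-sourced Hubbard Hamiltonians on finite graphs — locality, embeddings, boundary norms

Support file (`--supports stmt-HubbardSuperconductivity-15581`; no definition; the route file is NOT imported).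
Third layer of the infrastructure for the registered stub `stub_sourcedPressureLimit`. For a finite linearly
ordered site set `Λ`, a graph `G` (hopping `t`), real `U, μ, h` and PAIR WEIGHTS `w : Λ × Λ → ℂ` we consider the
pair-sourced grand-canonical Hubbard Hamiltonian (written out, no definition)

  `H(G, w) = hamiltonianWith G t U μ - h (P_w + P_wᴴ)`,  `P_w = Σ_{(x,y)} w(x,y) b_{xy}`,
  `b_{xy} = c_{x↑}c_{y↓} - c_{x↓}c_{y↑}` (`Literature.Barriers.HubbardSuperconductivity.bondPair`),

of which the route's `dWaveSourceTorus L U μ h` is the instance `G =` torus graph, `w =` d-wave torus weights.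
Proved here ([folklore] bookkeeping over `HubbardBondAlgebra`, `FermionEmbedding` and this seat's cut lemmas):

* `H(G,w) = V_Λ - Σ_b c_b T_b - h(P_w + P_wᴴ)` with the Hubbard couplings `c = hubbardCoupling G t`
  (`twR_hamiltonianWith_eq_onSiteSum_sub_hopSum`); locality of `P_w`, `P_wᴴ` (`twR_pairSum_mem`, `…_conjTranspose_mem`);
  second quantisation of order embeddings on `b_{xy}`, `P_w`, `Σ c_b T_b` (`twR_jwEmbed_bondPair`, …);
* **boundary norms**: if `G₁, G₂ ↪ G` along order embeddings with disjoint ranges, compatible adjacency and weights, then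
  `‖H(G,w) - (V_Λ + e₁_*(H(G₁,w₁) - V₁) + e₂_*(H(G₂,w₂) - V₂))‖ ≤ Σ_{b ∉ e₁(bonds) ∪ e₂(bonds)} ‖c_b‖ + 4|h| Σ_{z ∉ …} ‖w z‖`
  (`twR_norm_sub_cut_le`) and `‖H(G,w) - V_Λ‖ ≤ Σ_b ‖c_b‖ + 4|h| Σ_z ‖w z‖`;
* the resulting **free-energy estimates** `|log Z_β(H(G,w)) - |Λ| log z₀| ≤ β(…)` (`twR_abs_log_partitionFn_sub_card_mul_log_le`)
  and two blocks (`twR_abs_log_partitionFn_sourced_cut_le`).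

Ruelle, *Statistical Mechanics: Rigorous Results* (1969) §2.2; Ueltschi, J. Stat. Phys. 95 (1999) 693, §2.1.
-/

set_option linter.dupNamespace false

noncomputable section

namespace Summit.HubbardSuperconductivity.HubbardSuperconductivity.Theorems

open Literature.MathematicalPhysics.QuantumLattice Literature.Barriers.HubbardSuperconductivity Matrix Finset
  HubbardWave0
open scoped BigOperators Matrix.Norms.L2Operator

/-! ### Generic bookkeeping on one site set -/

section Generic

variable {Λ : Type*} [LinearOrder Λ] [Fintype Λ]

/-- `H_G(t,U) - μN = V_Λ - Σ_b c_b T_b` with the Hubbard couplings `c = t · 1_{bonds of G}`. [folklore] -/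
theorem twR_hamiltonianWith_eq_onSiteSum_sub_hopSum (G : SimpleGraph Λ) [DecidableRel G.Adj] (t U μ : ℝ) :
    hamiltonianWith G t U μ =
      onSiteSum (U : ℂ) (μ : ℂ) (Finset.univ : Finset Λ) - hopSum (hubbardCoupling G (t : ℂ)) := by
  rw [hamiltonianWith_eq_hoppingForm_add_diagonal, hopSum_hubbardCoupling, ← onSiteSum_univ, neg_smul]
  abel

/-- The singlet bond pair `b_{xy}` is an even local operator of `{x, y}`. [folklore] -/
theorem twR_bondPair_mem {A : Finset Λ} {x y : Λ} (hx : x ∈ A) (hy : y ∈ A) :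
    bondPair x y ∈ carEvenSubalgebra (orbs A) := by
  unfold bondPair
  exact Subalgebra.sub_mem _
    (Algebra.subset_adjoin ⟨(orb x 0, false), (orb y 1, false), orb_mem_orbs.2 hx, orb_mem_orbs.2 hy, rfl⟩)
    (Algebra.subset_adjoin ⟨(orb x 1, false), (orb y 0, false), orb_mem_orbs.2 hx, orb_mem_orbs.2 hy, rfl⟩)

/-- `b_{xy}ᴴ` is an even local operator of `{x, y}`. [folklore] -/
theorem twR_bondPair_conjTranspose_mem {A : Finset Λ} {x y : Λ} (hx : x ∈ A) (hy : y ∈ A) :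
    (bondPair x y)ᴴ ∈ carEvenSubalgebra (orbs A) := by
  rw [bondPair_conjTranspose]
  exact Subalgebra.sub_mem _
    (Algebra.subset_adjoin ⟨(orb y 1, true), (orb x 0, true), orb_mem_orbs.2 hy, orb_mem_orbs.2 hx, rfl⟩)
    (Algebra.subset_adjoin ⟨(orb y 0, true), (orb x 1, true), orb_mem_orbs.2 hy, orb_mem_orbs.2 hx, rfl⟩)

/-- `P_w` is an even local operator of `A` if `w` is supported on `A × A`. [folklore] -/
theorem twR_pairSum_mem {A : Finset Λ} {w : Λ × Λ → ℂ} (hw : ∀ z, w z ≠ 0 → z.1 ∈ A ∧ z.2 ∈ A) :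
    (∑ z : Λ × Λ, w z • bondPair z.1 z.2) ∈ carEvenSubalgebra (orbs A) := by
  refine Subalgebra.sum_mem _ fun z _ => ?_
  by_cases hz : w z = 0
  · rw [hz, zero_smul]; exact Subalgebra.zero_mem _
  · exact Subalgebra.smul_mem _ (twR_bondPair_mem (hw z hz).1 (hw z hz).2) _

/-- `P_wᴴ` is an even local operator of `A` if `w` is supported on `A × A`. [folklore] -/
theorem twR_pairSum_conjTranspose_mem {A : Finset Λ} {w : Λ × Λ → ℂ} (hw : ∀ z, w z ≠ 0 → z.1 ∈ A ∧ z.2 ∈ A) :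
    (∑ z : Λ × Λ, w z • bondPair z.1 z.2)ᴴ ∈ carEvenSubalgebra (orbs A) := by
  rw [conjTranspose_sum]
  refine Subalgebra.sum_mem _ fun z _ => ?_
  rw [conjTranspose_smul]
  by_cases hz : w z = 0
  · rw [hz, star_zero, zero_smul]; exact Subalgebra.zero_mem _
  · exact Subalgebra.smul_mem _ (twR_bondPair_conjTranspose_mem (hw z hz).1 (hw z hz).2) _

/-- The interaction part `H(G,w) - V_Λ = -Σ_b c_b T_b - h(P_w + P_wᴴ)`. [folklore] -/
theorem twR_sourced_sub_onSiteSum (G : SimpleGraph Λ) [DecidableRel G.Adj] (t U μ h : ℝ) (w : Λ × Λ → ℂ) :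
    hamiltonianWith G t U μ - (h : ℂ) • ((∑ z : Λ × Λ, w z • bondPair z.1 z.2) + (∑ z : Λ × Λ, w z • bondPair z.1 z.2)ᴴ) -
        onSiteSum (U : ℂ) (μ : ℂ) (Finset.univ : Finset Λ) =
      -hopSum (hubbardCoupling G (t : ℂ)) -
        (h : ℂ) • ((∑ z : Λ × Λ, w z • bondPair z.1 z.2) + (∑ z : Λ × Λ, w z • bondPair z.1 z.2)ᴴ) := by
  rw [twR_hamiltonianWith_eq_onSiteSum_sub_hopSum]
  abel

/-- The interaction part is even-local on the whole site set. [folklore] -/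
theorem twR_sourced_sub_onSiteSum_mem (G : SimpleGraph Λ) [DecidableRel G.Adj] (t U μ h : ℝ) (w : Λ × Λ → ℂ) :
    hamiltonianWith G t U μ - (h : ℂ) • ((∑ z : Λ × Λ, w z • bondPair z.1 z.2) + (∑ z : Λ × Λ, w z • bondPair z.1 z.2)ᴴ) -
        onSiteSum (U : ℂ) (μ : ℂ) (Finset.univ : Finset Λ) ∈
      carEvenSubalgebra (orbs (Finset.univ : Finset Λ)) := by
  rw [twR_sourced_sub_onSiteSum]
  refine Subalgebra.sub_mem _ (Subalgebra.neg_mem _ (hopSum_mem fun b _ => ⟨Finset.mem_univ _, Finset.mem_univ _⟩))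
    (Subalgebra.smul_mem _ (Subalgebra.add_mem _ (twR_pairSum_mem fun z _ => ⟨Finset.mem_univ _, Finset.mem_univ _⟩)
      (twR_pairSum_conjTranspose_mem fun z _ => ⟨Finset.mem_univ _, Finset.mem_univ _⟩)) _)

/-- `H(G, w)` is Hermitian for real `t, U, μ, h`. [folklore] -/
theorem twR_sourced_isHermitian (G : SimpleGraph Λ) [DecidableRel G.Adj] (t U μ h : ℝ) (w : Λ × Λ → ℂ) :
    (hamiltonianWith G t U μ -
      (h : ℂ) • ((∑ z : Λ × Λ, w z • bondPair z.1 z.2) + (∑ z : Λ × Λ, w z • bondPair z.1 z.2)ᴴ)).IsHermitian := by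
  refine (isHermitian_hamiltonianWith G t U μ).sub ?_
  have hS : ((∑ z : Λ × Λ, w z • bondPair z.1 z.2) + (∑ z : Λ × Λ, w z • bondPair z.1 z.2)ᴴ).IsHermitian :=
    Matrix.isHermitian_add_transpose_self _
  unfold IsHermitian at hS ⊢
  rw [conjTranspose_smul, hS, Complex.star_def, Complex.conj_ofReal]

/-- The interaction part `H(G,w) - V_Λ` is Hermitian. [folklore] -/
theorem twR_sourced_sub_onSiteSum_isHermitian (G : SimpleGraph Λ) [DecidableRel G.Adj] (t U μ h : ℝ)
    (w : Λ × Λ → ℂ) :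
    (hamiltonianWith G t U μ - (h : ℂ) • ((∑ z : Λ × Λ, w z • bondPair z.1 z.2) + (∑ z : Λ × Λ, w z • bondPair z.1 z.2)ᴴ) -
        onSiteSum (U : ℂ) (μ : ℂ) (Finset.univ : Finset Λ)).IsHermitian :=
  (twR_sourced_isHermitian G t U μ h w).sub (twR_onSiteSum_isHermitian U μ)

/-- `‖T_b‖ ≤ 1`. [folklore] -/
theorem twR_norm_bondOp_le (b : Bond Λ) : ‖(bondOp b : Matrix (Finset (Orb Λ)) (Finset (Orb Λ)) ℂ)‖ ≤ 1 :=
  (norm_mul_le _ _).trans (mul_le_one₀ (norm_creation_le_one _) (norm_nonneg _) (norm_annihilation_le_one _))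

omit [LinearOrder Λ] [Fintype Λ] in
/-- Norm of a weighted sum of uniformly bounded operators. [folklore] -/
theorem twR_norm_sum_smul_le {ι n : Type*} [Fintype n] [DecidableEq n] (s : Finset ι) (c : ι → ℂ)
    (A : ι → Matrix n n ℂ) {B : ℝ} (hA : ∀ i ∈ s, ‖A i‖ ≤ B) :
    ‖∑ i ∈ s, c i • A i‖ ≤ B * ∑ i ∈ s, ‖c i‖ := by
  rw [Finset.mul_sum]
  refine (norm_sum_le _ _).trans (Finset.sum_le_sum fun i hi => ?_)
  rw [norm_smul, mul_comm]
  exact mul_le_mul_of_nonneg_right (hA i hi) (norm_nonneg _)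

omit [LinearOrder Λ] [Fintype Λ] in
/-- `‖X + Xᴴ‖ ≤ 2‖X‖`. [folklore] -/
theorem twR_norm_add_conjTranspose_le {n : Type*} [Fintype n] [DecidableEq n] (X : Matrix n n ℂ) :
    ‖X + Xᴴ‖ ≤ 2 * ‖X‖ := by
  refine (norm_add_le _ _).trans ?_
  rw [l2_opNorm_conjTranspose]
  linarith

omit [LinearOrder Λ] in
/-- Splitting a sum over `univ` along two disjoint finsets and the complement of their union. [folklore] -/
theorem twR_sum_univ_sub_sub {ι M : Type*} [Fintype ι] [DecidableEq ι] [AddCommGroup M] {s₁ s₂ : Finset ι}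
    (h : Disjoint s₁ s₂) (F : ι → M) :
    ∑ i, F i - ∑ i ∈ s₁, F i - ∑ i ∈ s₂, F i = ∑ i ∈ (s₁ ∪ s₂)ᶜ, F i := by
  rw [← Finset.sum_compl_add_sum (s₁ ∪ s₂), Finset.sum_union h]
  abel

omit [LinearOrder Λ] in
/-- Splitting a sum over `univ` along one finset and its complement. [folklore] -/
theorem twR_sum_univ_sub {ι M : Type*} [Fintype ι] [DecidableEq ι] [AddCommGroup M] (s : Finset ι) (F : ι → M) :
    ∑ i, F i - ∑ i ∈ s, F i = ∑ i ∈ sᶜ, F i := by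
  rw [← Finset.sum_compl_add_sum s]
  abel

/-- **Zero-block norm**: `‖H(G,w) - V_Λ‖ ≤ Σ_b ‖c_b‖ + 4|h| Σ_z ‖w z‖`. [folklore] -/
theorem twR_norm_sourced_sub_onSiteSum_le (G : SimpleGraph Λ) [DecidableRel G.Adj] (t U μ h : ℝ) (w : Λ × Λ → ℂ) :
    ‖hamiltonianWith G t U μ - (h : ℂ) • ((∑ z : Λ × Λ, w z • bondPair z.1 z.2) + (∑ z : Λ × Λ, w z • bondPair z.1 z.2)ᴴ) -
        onSiteSum (U : ℂ) (μ : ℂ) (Finset.univ : Finset Λ)‖ ≤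
      ∑ b : Bond Λ, ‖hubbardCoupling G (t : ℂ) b‖ + 4 * |h| * ∑ z : Λ × Λ, ‖w z‖ := by
  rw [twR_sourced_sub_onSiteSum]
  have h1 : ‖hopSum (hubbardCoupling G (t : ℂ))‖ ≤ ∑ b : Bond Λ, ‖hubbardCoupling G (t : ℂ) b‖ := by
    have := twR_norm_sum_smul_le Finset.univ (hubbardCoupling G (t : ℂ)) (fun b => bondOp b) (B := 1)
      (fun b _ => twR_norm_bondOp_le b)
    simpa [hopSum] using this
  have h2 : ‖∑ z : Λ × Λ, w z • bondPair z.1 z.2‖ ≤ 2 * ∑ z : Λ × Λ, ‖w z‖ :=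
    twR_norm_sum_smul_le Finset.univ w (fun z => bondPair z.1 z.2) (fun z _ => norm_bondPair_le_two _ _)
  have h3 := twR_norm_add_conjTranspose_le (∑ z : Λ × Λ, w z • bondPair z.1 z.2)
  calc ‖-hopSum (hubbardCoupling G (t : ℂ)) -
        (h : ℂ) • ((∑ z : Λ × Λ, w z • bondPair z.1 z.2) + (∑ z : Λ × Λ, w z • bondPair z.1 z.2)ᴴ)‖
      ≤ ‖-hopSum (hubbardCoupling G (t : ℂ))‖ +
          ‖(h : ℂ) • ((∑ z : Λ × Λ, w z • bondPair z.1 z.2) + (∑ z : Λ × Λ, w z • bondPair z.1 z.2)ᴴ)‖ :=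
        norm_sub_le _ _
    _ ≤ ∑ b : Bond Λ, ‖hubbardCoupling G (t : ℂ) b‖ + |h| * (2 * (2 * ∑ z : Λ × Λ, ‖w z‖)) := by
        rw [norm_neg, norm_smul, Complex.norm_real, Real.norm_eq_abs]
        exact add_le_add h1 (mul_le_mul_of_nonneg_left (h3.trans (by linarith)) (abs_nonneg h))
    _ = ∑ b : Bond Λ, ‖hubbardCoupling G (t : ℂ) b‖ + 4 * |h| * ∑ z : Λ × Λ, ‖w z‖ := by ring

/-- **Zero-block free-energy estimate**: `|log Z_β(H(G,w)) - |Λ| log z₀| ≤ β (Σ_b ‖c_b‖ + 4|h| Σ_z ‖w z‖)`. [folklore] -/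
theorem twR_abs_log_partitionFn_sub_card_mul_log_le (G : SimpleGraph Λ) [DecidableRel G.Adj] {β : ℝ} (hβ : 0 ≤ β)
    (t U μ h : ℝ) (w : Λ × Λ → ℂ) :
    |Real.log (partitionFn β (hamiltonianWith G t U μ -
        (h : ℂ) • ((∑ z : Λ × Λ, w z • bondPair z.1 z.2) + (∑ z : Λ × Λ, w z • bondPair z.1 z.2)ᴴ))).re -
        Fintype.card Λ * Real.log (atomicPartitionFnReal β U μ)| ≤
      β * (∑ b : Bond Λ, ‖hubbardCoupling G (t : ℂ) b‖ + 4 * |h| * ∑ z : Λ × Λ, ‖w z‖) := by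
  have h1 := abs_log_partitionFn_sub_log_partitionFn_le (twR_sourced_isHermitian G t U μ h w)
    (twR_onSiteSum_isHermitian (Λ := Λ) U μ) hβ
  rw [twR_log_partitionFn_onSiteSum] at h1
  exact h1.trans (mul_le_mul_of_nonneg_left (twR_norm_sourced_sub_onSiteSum_le G t U μ h w) hβ)

end Generic

/-! ### Second quantisation of order embeddings on the sourced Hamiltonians -/

section Embed

variable {Λ Λ₁ : Type*} [LinearOrder Λ] [Fintype Λ] [LinearOrder Λ₁] [Fintype Λ₁]

/-- `e_* b_{xy} = b_{e x, e y}`. [folklore] -/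
theorem twR_jwEmbed_bondPair (e : Λ₁ ↪o Λ) (x y : Λ₁) :
    jwEmbed (orbEmb e) (bondPair x y) = bondPair (e x) (e y) := by
  simp only [bondPair, map_sub, map_mul, jwEmbed_annihilation, orbEmb_orb]

/-- `e_* P_w = Σ_z w z b_{e z₁, e z₂}`. [folklore] -/
theorem twR_jwEmbed_pairSum (e : Λ₁ ↪o Λ) (w : Λ₁ × Λ₁ → ℂ) :
    jwEmbed (orbEmb e) (∑ z : Λ₁ × Λ₁, w z • bondPair z.1 z.2) = ∑ z : Λ₁ × Λ₁, w z • bondPair (e z.1) (e z.2) := by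
  rw [map_sum]
  exact Finset.sum_congr rfl fun z _ => by rw [map_smul, twR_jwEmbed_bondPair]

/-- `e_* (Σ_b c_b T_b) = Σ_b c_b T_{e b}`. [folklore] -/
theorem twR_jwEmbed_hopSum_eq_sum (e : Λ₁ ↪o Λ) (c : Bond Λ₁ → ℂ) :
    jwEmbed (orbEmb e) (hopSum c) = ∑ b : Bond Λ₁, c b • bondOp (bondMap e b) := by
  rw [hopSum, map_sum]
  exact Finset.sum_congr rfl fun b _ => by rw [map_smul, jwEmbed_bondOp]

omit [Fintype Λ] [Fintype Λ₁] in
/-- The induced map on ordered site pairs is injective. [folklore] -/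
theorem twR_prodMap_injective (e : Λ₁ ↪o Λ) : Function.Injective (Prod.map e e) :=
  e.injective.prodMap e.injective

/-- **The embedded interaction part**, under compatibility of adjacency and weights: `e_*(H(G₁,w₁) - V_{Λ₁})` is
`-Σ_{b ∈ e(bonds)} c_b T_b - h(Σ_{z ∈ e(pairs)} w z b_z + h.c.)` with the couplings/weights of the BIG system.
[folklore] -/
theorem twR_jwEmbed_sourced_sub_onSiteSum (e : Λ₁ ↪o Λ) (G : SimpleGraph Λ) [DecidableRel G.Adj]
    (G₁ : SimpleGraph Λ₁) [DecidableRel G₁.Adj] (hG : ∀ x y, G₁.Adj x y ↔ G.Adj (e x) (e y)) (t U μ h : ℝ)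
    (w : Λ × Λ → ℂ) (w₁ : Λ₁ × Λ₁ → ℂ) (hw : ∀ z, w₁ z = w (Prod.map e e z)) :
    jwEmbed (orbEmb e) (hamiltonianWith G₁ t U μ -
        (h : ℂ) • ((∑ z : Λ₁ × Λ₁, w₁ z • bondPair z.1 z.2) + (∑ z : Λ₁ × Λ₁, w₁ z • bondPair z.1 z.2)ᴴ) -
        onSiteSum (U : ℂ) (μ : ℂ) (Finset.univ : Finset Λ₁)) =
      -(∑ b ∈ (Finset.univ : Finset (Bond Λ₁)).map ⟨bondMap e, bondMap_injective e⟩, hubbardCoupling G (t : ℂ) b • bondOp b) -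
        (h : ℂ) • ((∑ z ∈ (Finset.univ : Finset (Λ₁ × Λ₁)).map ⟨Prod.map e e, twR_prodMap_injective e⟩, w z • bondPair z.1 z.2) +
          (∑ z ∈ (Finset.univ : Finset (Λ₁ × Λ₁)).map ⟨Prod.map e e, twR_prodMap_injective e⟩, w z • bondPair z.1 z.2)ᴴ) := by
  have hc : ∀ b : Bond Λ₁, hubbardCoupling G₁ (t : ℂ) b = hubbardCoupling G (t : ℂ) (bondMap e b) := by
    intro b
    simp only [hubbardCoupling_apply, bondMap, hG]
  have hP : jwEmbed (orbEmb e) (∑ z : Λ₁ × Λ₁, w₁ z • bondPair z.1 z.2) =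
      ∑ z ∈ (Finset.univ : Finset (Λ₁ × Λ₁)).map ⟨Prod.map e e, twR_prodMap_injective e⟩, w z • bondPair z.1 z.2 := by
    rw [twR_jwEmbed_pairSum, Finset.sum_map]
    exact Finset.sum_congr rfl fun z _ => by rw [hw]; rfl
  have hT : jwEmbed (orbEmb e) (hopSum (hubbardCoupling G₁ (t : ℂ))) =
      ∑ b ∈ (Finset.univ : Finset (Bond Λ₁)).map ⟨bondMap e, bondMap_injective e⟩, hubbardCoupling G (t : ℂ) b • bondOp b := by
    rw [twR_jwEmbed_hopSum_eq_sum, Finset.sum_map]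
    exact Finset.sum_congr rfl fun b _ => by rw [hc]; rfl
  rw [twR_sourced_sub_onSiteSum, map_sub, map_neg, map_smul, map_add, jwEmbed_conjTranspose, hP, hT]

end Embed

/-! ### Two blocks -/

section Cut

variable {Λ Λ₁ Λ₂ : Type*} [LinearOrder Λ] [Fintype Λ] [LinearOrder Λ₁] [Fintype Λ₁] [LinearOrder Λ₂] [Fintype Λ₂]

omit [Fintype Λ] [Fintype Λ₁] [Fintype Λ₂] in
/-- Disjoint site ranges give disjoint bond ranges. [folklore] -/
theorem twR_disjoint_map_bondMap (e₁ : Λ₁ ↪o Λ) (e₂ : Λ₂ ↪o Λ) (s₁ : Finset (Bond Λ₁)) (s₂ : Finset (Bond Λ₂))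
    (h : ∀ x y, e₁ x ≠ e₂ y) :
    Disjoint (s₁.map ⟨bondMap e₁, bondMap_injective e₁⟩) (s₂.map ⟨bondMap e₂, bondMap_injective e₂⟩) := by
  rw [Finset.disjoint_left]
  intro b hb₁ hb₂
  obtain ⟨b₁, _, rfl⟩ := Finset.mem_map.1 hb₁
  obtain ⟨b₂, _, hb⟩ := Finset.mem_map.1 hb₂
  exact h b₁.1 b₂.1 (congrArg Prod.fst hb).symm

omit [Fintype Λ] [Fintype Λ₁] [Fintype Λ₂] in
/-- Disjoint site ranges give disjoint pair ranges. [folklore] -/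
theorem twR_disjoint_map_prodMap (e₁ : Λ₁ ↪o Λ) (e₂ : Λ₂ ↪o Λ) (s₁ : Finset (Λ₁ × Λ₁)) (s₂ : Finset (Λ₂ × Λ₂))
    (h : ∀ x y, e₁ x ≠ e₂ y) :
    Disjoint (s₁.map ⟨Prod.map e₁ e₁, twR_prodMap_injective e₁⟩) (s₂.map ⟨Prod.map e₂ e₂, twR_prodMap_injective e₂⟩) := by
  rw [Finset.disjoint_left]
  intro z hz₁ hz₂
  obtain ⟨z₁, _, rfl⟩ := Finset.mem_map.1 hz₁
  obtain ⟨z₂, _, hz⟩ := Finset.mem_map.1 hz₂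
  exact h z₁.1 z₂.1 (congrArg Prod.fst hz).symm

/-- **Two-block boundary norm**: under compatibility and disjoint ranges,
`‖H(G,w) - (V_Λ + e₁_*(H(G₁,w₁) - V₁) + e₂_*(H(G₂,w₂) - V₂))‖ ≤ Σ_{b ∉ e₁(bonds) ∪ e₂(bonds)} ‖c_b‖ + 4|h| Σ_{z ∉ …} ‖w z‖`.
[folklore] -/
theorem twR_norm_sub_cut_le (e₁ : Λ₁ ↪o Λ) (e₂ : Λ₂ ↪o Λ) (hne : ∀ x y, e₁ x ≠ e₂ y)
    (G : SimpleGraph Λ) [DecidableRel G.Adj] (G₁ : SimpleGraph Λ₁) [DecidableRel G₁.Adj] (G₂ : SimpleGraph Λ₂) [DecidableRel G₂.Adj]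
    (hG₁ : ∀ x y, G₁.Adj x y ↔ G.Adj (e₁ x) (e₁ y)) (hG₂ : ∀ x y, G₂.Adj x y ↔ G.Adj (e₂ x) (e₂ y)) (t U μ h : ℝ)
    (w : Λ × Λ → ℂ) (w₁ : Λ₁ × Λ₁ → ℂ) (w₂ : Λ₂ × Λ₂ → ℂ) (hw₁ : ∀ z, w₁ z = w (Prod.map e₁ e₁ z))
    (hw₂ : ∀ z, w₂ z = w (Prod.map e₂ e₂ z)) :
    ‖(hamiltonianWith G t U μ - (h : ℂ) • ((∑ z : Λ × Λ, w z • bondPair z.1 z.2) + (∑ z : Λ × Λ, w z • bondPair z.1 z.2)ᴴ)) -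
        (onSiteSum (U : ℂ) (μ : ℂ) (Finset.univ : Finset Λ) +
          jwEmbed (orbEmb e₁) (hamiltonianWith G₁ t U μ -
            (h : ℂ) • ((∑ z : Λ₁ × Λ₁, w₁ z • bondPair z.1 z.2) + (∑ z : Λ₁ × Λ₁, w₁ z • bondPair z.1 z.2)ᴴ) -
            onSiteSum (U : ℂ) (μ : ℂ) (Finset.univ : Finset Λ₁)) +
          jwEmbed (orbEmb e₂) (hamiltonianWith G₂ t U μ -
            (h : ℂ) • ((∑ z : Λ₂ × Λ₂, w₂ z • bondPair z.1 z.2) + (∑ z : Λ₂ × Λ₂, w₂ z • bondPair z.1 z.2)ᴴ) -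
            onSiteSum (U : ℂ) (μ : ℂ) (Finset.univ : Finset Λ₂)))‖ ≤
      ∑ b ∈ ((Finset.univ : Finset (Bond Λ₁)).map ⟨bondMap e₁, bondMap_injective e₁⟩ ∪
          (Finset.univ : Finset (Bond Λ₂)).map ⟨bondMap e₂, bondMap_injective e₂⟩)ᶜ, ‖hubbardCoupling G (t : ℂ) b‖ +
        4 * |h| * ∑ z ∈ ((Finset.univ : Finset (Λ₁ × Λ₁)).map ⟨Prod.map e₁ e₁, twR_prodMap_injective e₁⟩ ∪
          (Finset.univ : Finset (Λ₂ × Λ₂)).map ⟨Prod.map e₂ e₂, twR_prodMap_injective e₂⟩)ᶜ, ‖w z‖ := by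
  set imB₁ := (Finset.univ : Finset (Bond Λ₁)).map ⟨bondMap e₁, bondMap_injective e₁⟩ with himB₁
  set imB₂ := (Finset.univ : Finset (Bond Λ₂)).map ⟨bondMap e₂, bondMap_injective e₂⟩ with himB₂
  set imP₁ := (Finset.univ : Finset (Λ₁ × Λ₁)).map ⟨Prod.map e₁ e₁, twR_prodMap_injective e₁⟩ with himP₁
  set imP₂ := (Finset.univ : Finset (Λ₂ × Λ₂)).map ⟨Prod.map e₂ e₂, twR_prodMap_injective e₂⟩ with himP₂
  have dB : Disjoint imB₁ imB₂ := twR_disjoint_map_bondMap e₁ e₂ _ _ hne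
  have dP : Disjoint imP₁ imP₂ := twR_disjoint_map_prodMap e₁ e₂ _ _ hne
  rw [twR_jwEmbed_sourced_sub_onSiteSum e₁ G G₁ hG₁ t U μ h w w₁ hw₁,
    twR_jwEmbed_sourced_sub_onSiteSum e₂ G G₂ hG₂ t U μ h w w₂ hw₂]
  set A := ∑ b ∈ (imB₁ ∪ imB₂)ᶜ, hubbardCoupling G (t : ℂ) b • bondOp b with hA
  set B := ∑ z ∈ (imP₁ ∪ imP₂)ᶜ, w z • bondPair z.1 z.2 with hB
  have key : (hamiltonianWith G t U μ - (h : ℂ) • ((∑ z : Λ × Λ, w z • bondPair z.1 z.2) + (∑ z : Λ × Λ, w z • bondPair z.1 z.2)ᴴ)) -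
      (onSiteSum (U : ℂ) (μ : ℂ) (Finset.univ : Finset Λ) +
        (-(∑ b ∈ imB₁, hubbardCoupling G (t : ℂ) b • bondOp b) -
          (h : ℂ) • ((∑ z ∈ imP₁, w z • bondPair z.1 z.2) + (∑ z ∈ imP₁, w z • bondPair z.1 z.2)ᴴ)) +
        (-(∑ b ∈ imB₂, hubbardCoupling G (t : ℂ) b • bondOp b) -
          (h : ℂ) • ((∑ z ∈ imP₂, w z • bondPair z.1 z.2) + (∑ z ∈ imP₂, w z • bondPair z.1 z.2)ᴴ))) =
      -A - (h : ℂ) • (B + Bᴴ) := by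
    have eA : hopSum (hubbardCoupling G (t : ℂ)) - ∑ b ∈ imB₁, hubbardCoupling G (t : ℂ) b • bondOp b -
        ∑ b ∈ imB₂, hubbardCoupling G (t : ℂ) b • bondOp b = A := by
      rw [hA, hopSum]; exact twR_sum_univ_sub_sub dB _
    have eB : (∑ z : Λ × Λ, w z • bondPair z.1 z.2) - ∑ z ∈ imP₁, w z • bondPair z.1 z.2 -
        ∑ z ∈ imP₂, w z • bondPair z.1 z.2 = B := by
      rw [hB]; exact twR_sum_univ_sub_sub dP _
    rw [twR_hamiltonianWith_eq_onSiteSum_sub_hopSum, ← eA, ← eB]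
    simp only [conjTranspose_sub, smul_add, smul_sub]
    abel
  rw [key]
  have h1 : ‖A‖ ≤ ∑ b ∈ (imB₁ ∪ imB₂)ᶜ, ‖hubbardCoupling G (t : ℂ) b‖ := by
    have := twR_norm_sum_smul_le (imB₁ ∪ imB₂)ᶜ (hubbardCoupling G (t : ℂ)) (fun b => bondOp b) (B := 1)
      (fun b _ => twR_norm_bondOp_le b)
    simpa [hA] using this
  have h2 : ‖B‖ ≤ 2 * ∑ z ∈ (imP₁ ∪ imP₂)ᶜ, ‖w z‖ :=
    twR_norm_sum_smul_le (imP₁ ∪ imP₂)ᶜ w (fun z => bondPair z.1 z.2) (fun z _ => norm_bondPair_le_two _ _)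
  have h3 := twR_norm_add_conjTranspose_le B
  calc ‖-A - (h : ℂ) • (B + Bᴴ)‖ ≤ ‖-A‖ + ‖(h : ℂ) • (B + Bᴴ)‖ := norm_sub_le _ _
    _ ≤ ∑ b ∈ (imB₁ ∪ imB₂)ᶜ, ‖hubbardCoupling G (t : ℂ) b‖ + |h| * (2 * (2 * ∑ z ∈ (imP₁ ∪ imP₂)ᶜ, ‖w z‖)) := by
        rw [norm_neg, norm_smul, Complex.norm_real, Real.norm_eq_abs]
        exact add_le_add h1 (mul_le_mul_of_nonneg_left (h3.trans (by linarith)) (abs_nonneg h))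
    _ = ∑ b ∈ (imB₁ ∪ imB₂)ᶜ, ‖hubbardCoupling G (t : ℂ) b‖ + 4 * |h| * ∑ z ∈ (imP₁ ∪ imP₂)ᶜ, ‖w z‖ := by ring

/-- **Two-block free-energy estimate for sourced Hubbard Hamiltonians** (row/column cuts of rectangles are the
instances): under compatibility, disjoint ranges and `|Λ₁| + |Λ₂| = |Λ|`,
`|log Z_β(H(G,w)) - (log Z_β(H(G₁,w₁)) + log Z_β(H(G₂,w₂)))| ≤ β (Σ_{b ∉ …} ‖c_b‖ + 4|h| Σ_{z ∉ …} ‖w z‖)`. [folklore] -/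
theorem twR_abs_log_partitionFn_sourced_cut_le (e₁ : Λ₁ ↪o Λ) (e₂ : Λ₂ ↪o Λ) (hne : ∀ x y, e₁ x ≠ e₂ y)
    (hcard : Fintype.card Λ₁ + Fintype.card Λ₂ = Fintype.card Λ)
    (G : SimpleGraph Λ) [DecidableRel G.Adj] (G₁ : SimpleGraph Λ₁) [DecidableRel G₁.Adj] (G₂ : SimpleGraph Λ₂) [DecidableRel G₂.Adj]
    (hG₁ : ∀ x y, G₁.Adj x y ↔ G.Adj (e₁ x) (e₁ y)) (hG₂ : ∀ x y, G₂.Adj x y ↔ G.Adj (e₂ x) (e₂ y)) {β : ℝ} (hβ : 0 ≤ β)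
    (t U μ h : ℝ) (w : Λ × Λ → ℂ) (w₁ : Λ₁ × Λ₁ → ℂ) (w₂ : Λ₂ × Λ₂ → ℂ) (hw₁ : ∀ z, w₁ z = w (Prod.map e₁ e₁ z))
    (hw₂ : ∀ z, w₂ z = w (Prod.map e₂ e₂ z)) :
    |Real.log (partitionFn β (hamiltonianWith G t U μ -
        (h : ℂ) • ((∑ z : Λ × Λ, w z • bondPair z.1 z.2) + (∑ z : Λ × Λ, w z • bondPair z.1 z.2)ᴴ))).re -
        (Real.log (partitionFn β (hamiltonianWith G₁ t U μ -
          (h : ℂ) • ((∑ z : Λ₁ × Λ₁, w₁ z • bondPair z.1 z.2) + (∑ z : Λ₁ × Λ₁, w₁ z • bondPair z.1 z.2)ᴴ))).re +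
         Real.log (partitionFn β (hamiltonianWith G₂ t U μ -
          (h : ℂ) • ((∑ z : Λ₂ × Λ₂, w₂ z • bondPair z.1 z.2) + (∑ z : Λ₂ × Λ₂, w₂ z • bondPair z.1 z.2)ᴴ))).re)| ≤
      β * (∑ b ∈ ((Finset.univ : Finset (Bond Λ₁)).map ⟨bondMap e₁, bondMap_injective e₁⟩ ∪
          (Finset.univ : Finset (Bond Λ₂)).map ⟨bondMap e₂, bondMap_injective e₂⟩)ᶜ, ‖hubbardCoupling G (t : ℂ) b‖ +
        4 * |h| * ∑ z ∈ ((Finset.univ : Finset (Λ₁ × Λ₁)).map ⟨Prod.map e₁ e₁, twR_prodMap_injective e₁⟩ ∪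
          (Finset.univ : Finset (Λ₂ × Λ₂)).map ⟨Prod.map e₂ e₂, twR_prodMap_injective e₂⟩)ᶜ, ‖w z‖) := by
  have hdisj : Disjoint ((Finset.univ : Finset Λ₁).map e₁.toEmbedding) ((Finset.univ : Finset Λ₂).map e₂.toEmbedding) := by
    rw [Finset.disjoint_left]
    intro x hx₁ hx₂
    obtain ⟨a, _, rfl⟩ := Finset.mem_map.1 hx₁
    obtain ⟨b, _, hb⟩ := Finset.mem_map.1 hx₂
    exact hne a b hb.symm
  have key := twR_abs_log_partitionFn_sub_cut_le e₁ e₂ hdisj hcard hβ U μ (twR_sourced_isHermitian G t U μ h w)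
    (twR_sourced_sub_onSiteSum_isHermitian G₁ t U μ h w₁) (twR_sourced_sub_onSiteSum_mem G₁ t U μ h w₁)
    (twR_sourced_sub_onSiteSum_isHermitian G₂ t U μ h w₂) (twR_sourced_sub_onSiteSum_mem G₂ t U μ h w₂)
    (twR_norm_sub_cut_le e₁ e₂ hne G G₁ G₂ hG₁ hG₂ t U μ h w w₁ w₂ hw₁ hw₂)
  rwa [add_sub_cancel, add_sub_cancel] at key

end Cut

/-! ### Summary (registered sub-goal of stmt-HubbardSuperconductivity-15581) -/

/-- **Registered sub-goal `twR_sourcedCutEstimate`** (infrastructure for `stub_sourcedPressureLimit`): the two-block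
free-energy estimate for pair-sourced Hubbard Hamiltonians, for site types in `Type`. [folklore] -/
theorem twR_sourcedCutEstimate : ∀ (Λ Λ₁ Λ₂ : Type) [LinearOrder Λ] [Fintype Λ] [LinearOrder Λ₁] [Fintype Λ₁] [LinearOrder Λ₂] [Fintype Λ₂] (e₁ : Λ₁ ↪o Λ) (e₂ : Λ₂ ↪o Λ), (∀ x y, e₁ x ≠ e₂ y) → Fintype.card Λ₁ + Fintype.card Λ₂ = Fintype.card Λ → ∀ (G : SimpleGraph Λ) [DecidableRel G.Adj] (G₁ : SimpleGraph Λ₁) [DecidableRel G₁.Adj] (G₂ : SimpleGraph Λ₂) [DecidableRel G₂.Adj], (∀ x y, G₁.Adj x y ↔ G.Adj (e₁ x) (e₁ y)) → (∀ x y, G₂.Adj x y ↔ G.Adj (e₂ x) (e₂ y)) → ∀ (β t U μ h : ℝ), 0 ≤ β → ∀ (w : Λ × Λ → ℂ) (w₁ : Λ₁ × Λ₁ → ℂ) (w₂ : Λ₂ × Λ₂ → ℂ), (∀ z, w₁ z = w (Prod.map e₁ e₁ z)) → (∀ z, w₂ z = w (Prod.map e₂ e₂ z)) → |Real.log (Matrix.partitionFn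 β (hamiltonianWith G t U μ - (h : ℂ) • ((∑ z : Λ × Λ, w z • Literature.Barriers.HubbardSuperconductivity.bondPair z.1 z.2) + (∑ z : Λ × Λ, w z • Literature.Barriers.HubbardSuperconductivity.bondPair z.1 z.2)ᴴ))).re - (Real.log (Matrix.partitionFn β (hamiltonianWith G₁ t U μ - (h : ℂ) • ((∑ z : Λ₁ × Λ₁, w₁ z • Literature.Barriers.HubbardSuperconductivity.bondPair z.1 z.2) + (∑ z : Λ₁ × Λ₁, w₁ z • Literature.Barriers.HubbardSuperconductivity.bondPair z.1 z.2)ᴴ))).re + Real.log (Matrix.partitionFn β (hamiltonianWith G₂ t U μ - (h : ℂ) • ((∑ z : Λ₂ × Λ₂, w₂ z • Literature.Barriers.HubbardSuperconductivity.bondPair z.1 z.2) + (∑ z : Λ₂ × Λ₂, w₂ z • Literature.Barriers.HubbardSuperconductivity.bondPair z.1 z.2)ᴴ))).re)| ≤ β * (∑ b ∈ ((Finset.univ : Finset (Bond Λ₁)).map ⟨bondMap e₁, bondMap_injective e₁⟩ ∪ (Finset.univ : Finset (Bond Λ₂)).map ⟨bondMap e₂, bondMap_injective e₂⟩)ᶜ,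 ‖hubbardCoupling G (t : ℂ) b‖ + 4 * |h| * ∑ z ∈ ((Finset.univ : Finset (Λ₁ × Λ₁)).map ⟨Prod.map e₁ e₁, e₁.injective.prodMap e₁.injective⟩ ∪ (Finset.univ : Finset (Λ₂ × Λ₂)).map ⟨Prod.map e₂ e₂, e₂.injective.prodMap e₂.injective⟩)ᶜ, ‖w z‖) :=
  fun _ _ _ _ _ _ _ _ _ e₁ e₂ hne hcard G _ G₁ _ G₂ _ hG₁ hG₂ _ t U μ h hβ w w₁ w₂ hw₁ hw₂ =>
    twR_abs_log_partitionFn_sourced_cut_le e₁ e₂ hne hcard G G₁ G₂ hG₁ hG₂ hβ t U μ h w w₁ w₂ hw₁ hw₂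

end Summit.HubbardSuperconductivity.HubbardSuperconductivity.Theorems

end
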